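import Summits.QuantumFields.GaugeBoot.ClassBLimitSiteRP
import Summits.QuantumFields.GaugeBoot.ClassBLimitLinkRP
import Summits.QuantumFields.YangMills.Theorems.FradkinShenkerFlowClusteringToYangMillsStubReconstructibleGeometry
import Summits.QuantumFields.YangMills.Theorems.FradkinShenkerFlowClusteringToYangMillsStubCylinderApprox
import Literature.MathematicalPhysics.QuantumFieldTheory.GaugeOSData
import Literature.Probability.LatticeModels.OSReconstruction
import HarnessLib

/-!
# Infinite-volume reflection positivity, VII: every torus limit point is Osterwalder–Schrader reconstructible (any side parity)

R136 (i) «infinite-volume ∕ continuum-from-UV» programme (director-ym), prover seat `ym-infvol-p3` (g3), filed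
`--supports` the spine leg `UV` (stmt-QuantumFields-19351) of `route-QuantumFields-BalabanLadder` as a helper for the
junction ruling (c′) «torus parity» (owner ym-beyond-p2, 2026-08-26; KNIT5-SCOPE S2 «which RP lemmas»): Track A's
lattices are the EVEN tori `2·L^(m+K-j)`, the spine's legs and `GaugeOSData` speak of ODD tori `2S+1`; the OS
reconstruction input of the infinite-volume side must therefore be available for limit states taken along tori of ANY
side. HONEST FRAMING: soft lattice analysis about arbitrary infinite-volume limit states of the torus Wilson states of
an arbitrary compact group at `β ≥ 0`; nothing here is a mass gap, a continuum limit or Clay; NOTHING is asserted about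
Yang–Mills beyond what is proved.

## Content (namespace `Summit.QuantumFields.YangMills.Theorems.InfVolRP`)

The tree's OS-reconstruction premise for a state `μ` on `ℤ⁴` gauge fields is
`IsOSReconstructible μ gaugeTimeReflect gaugeTimeShift (posTimeEvents G)` (`Literature/…/OSReconstruction.lean`,
`GaugeOSData.lean`: BOND time reflection `Θ : x₀ ↦ -1 - x₀`, unit time shift `τ`, positive-time σ-algebra `𝓔₊`). So far
the tree proved it only for ODD-torus limit states and under two side conditions
(`CriticalContinuumLimit.AdmissibleGap.isOSReconstructible_of_oddTorusLimit r hβ μ (hμ : μ ∈ oddTorusLimitPoints r β)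
(hAP : CylinderApprox μ) (hExt : CylinderExt G)`, via Wave 0's odd-torus mixed reflection). This file proves it for
EVERY infinite-volume limit point along tori of ANY side (`μ ∈ infiniteVolumeLimitPoints ρ β`: limits along some
strictly increasing sequence of torus sides `L_k + 1`, even or odd) and WITHOUT the two side conditions:

* §1 geometry: `Θ = τ ∘ Θ_site` (`gaugeTimeReflect_eq_gaugeTimeShift_configSiteReflect`), `τ ∘ Θ_link = Θ ∘ τ`
  (`gaugeTimeShift_configLinkReflect`), where `Θ_site = configSiteReflect 0` (mirror `x₀ = 0`) and
  `Θ_link = configLinkReflect 0` (mirror `x₀ = ½`) are the gauge-boot cell's reflections of `ClassB.lean`; positive-time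
  observables shifted by `τ` live in the link half `{x₀ ≥ 1}` (`dependsOn_comp_gaugeTimeShift`).
* §2 invariances of limit points under `τ` and `Θ` (translation invariance, tree
  `isZdTranslationInvariant_of_mem_infiniteVolumeLimitPoints`; axis-reflection invariance, gauge-boot
  `reflectInvariant_of_mem_infiniteVolumeLimitPoints`).
* §3 the four OS premises: `rp` from LINK reflection positivity of limit points
  (gauge-boot `linkRP_zero_of_mem_infiniteVolumeLimitPoints`, even tori by `wilsonExpectation_reflectionPositive_holds`,
  odd tori by `wilsonExpectation_oddReflectionPositive`) transported by `τ`; `rp_shift` (RP half a step up) from SITE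
  reflection positivity (`siteRP_zero_of_mem_infiniteVolumeLimitPoints`); `conj_symm` from `Θ`-invariance and
  `Θ ∘ Θ = id`; `shift_symm` from `τ`-invariance and `τ ∘ Θ ∘ τ = Θ`.
* §4 **`isOSReconstructible_of_mem_infiniteVolumeLimitPoints`** and its corollaries in the two currencies of the
  programme: limits along a given side sequence (`…_of_isInfiniteVolumeLimitAlong`, p2's raw-side classes) and odd-torus
  limit states (`…_of_mem_oddTorusLimitPoints`, the hypothesis-free form of the `AdmissibleGap` theorem).

References: K. Osterwalder, E. Seiler, Ann. Phys. 110 (1978) 440, §2; J. Fröhlich, R. Israel, E. H. Lieb, B. Simon,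
Commun. Math. Phys. 62 (1978) 1, §3 (reflections through sites and through bonds); J. Glimm, A. Jaffe, *Quantum Physics*
(1987) Thm. 6.1.3; E. Seiler, LNP 159 (1982) Ch. 2.
-/

noncomputable section

open scoped BigOperators ComplexConjugate ComplexOrder
open MeasureTheory Filter Topology
open Literature.MathematicalPhysics.QuantumFieldTheory Literature.MathematicalPhysics.QuantumLattice
open Literature.Probability.LatticeModels (IsOSReconstructible IsBoundedMeasurable positiveEvents osForm)
open Summit.QuantumFields.GaugeBoot (configSiteReflect configLinkReflect zdSiteReflect zdLinkReflect siteHalfEdges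
  linkHalfEdges IsReflectionPositiveFor configSiteReflect_apply configLinkReflect_apply configLinkReflect_zero_eq
  measurable_configSiteReflect siteRP_zero_of_mem_infiniteVolumeLimitPoints linkRP_zero_of_mem_infiniteVolumeLimitPoints
  reflectInvariant_of_mem_infiniteVolumeLimitPoints)
open Summit.QuantumFields.YangMills.Theorems.ClusteringToYangMills (dependsOn_of_measurable_cylinderEvents')
open Summit.QuantumFields.YangMills.Theorems.ClusteringToYangMills.Reconstructible

namespace Summit.QuantumFields.YangMills.Theorems.InfVolRP

/-! ### §1. Geometry: the bond reflection versus the gauge-boot site and link reflections -/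

section Geometry

variable {G : Type} [Group G]

/-- **`Θ = τ ∘ Θ_site`**: the bond time reflection (`x₀ ↦ -1 - x₀`) is the site reflection in `x₀ = 0` followed by the
unit time shift. [folklore] -/
theorem gaugeTimeReflect_eq_gaugeTimeShift_configSiteReflect [MeasurableSpace G] (U : LGConfig 4 G) :
    gaugeTimeReflect U = gaugeTimeShift (configSiteReflect 0 U) := by
  funext e
  obtain ⟨x, i⟩ := e
  have h1 : (zdSiteReflect 0 (x + Pi.single 0 1) : Literature.Probability.LatticeModels.Site 4) =
      latticeTimeReflection 4 x := by
    ext j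
    by_cases hj : j = 0
    · subst hj
      simp only [zdSiteReflect, latticeTimeReflection_apply, Function.update_self, Pi.add_apply,
        Pi.single_eq_same]
      ring
    · simp only [zdSiteReflect, latticeTimeReflection_apply, Function.update_of_ne hj, Pi.add_apply,
        Pi.single_eq_of_ne hj, add_zero]
  have h2 : (zdSiteReflect 0 (x + Pi.single 0 1) - Pi.single 0 1 : Literature.Probability.LatticeModels.Site 4) =
      latticeTimeReflection 4 (x + Pi.single 0 1) := by
    ext j
    by_cases hj : j = 0
    · subst hj
      simp only [zdSiteReflect, latticeTimeReflection_apply, Function.update_self, Pi.add_apply, Pi.sub_apply,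
        Pi.single_eq_same]
      ring
    · simp only [zdSiteReflect, latticeTimeReflection_apply, Function.update_of_ne hj, Pi.add_apply, Pi.sub_apply,
        Pi.single_eq_of_ne hj, add_zero, sub_zero]
  rw [gaugeTimeShift_apply, gaugeTimeReflect_apply, configSiteReflect_apply]
  by_cases hi : i = 0
  · subst hi
    rw [if_pos rfl, if_pos rfl, h2]
  · rw [if_neg hi, if_neg hi, h1]

/-- **`τ ∘ Θ_link = Θ ∘ τ`**: the link reflection (`x₀ ↦ 1 - x₀`) followed by the unit time shift is the unit time shift
followed by the bond time reflection. [folklore] -/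
theorem gaugeTimeShift_configLinkReflect [MeasurableSpace G] (U : LGConfig 4 G) :
    gaugeTimeShift (configLinkReflect 0 U) = gaugeTimeReflect (gaugeTimeShift U) := by
  rw [configLinkReflect_zero_eq, gaugeTimeReflect_eq_gaugeTimeShift_configSiteReflect]
  rfl

omit [Group G] in
/-- A positive-time observable shifted by `τ` depends only on the links of the link half `{x₀ ≥ 1}`. [folklore] -/
theorem dependsOn_comp_gaugeTimeShift [MeasurableSpace G] {α : Type*} {F : LGConfig 4 G → α}
    (hF : DependsOn F posTimeEdges) : DependsOn (F ∘ gaugeTimeShift) (linkHalfEdges 0) := by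
  intro U V hUV
  simp only [Function.comp_apply]
  refine hF fun e he => ?_
  simp only [gaugeTimeShift_apply]
  refine hUV _ ?_
  simp only [mem_posTimeEdges] at he
  simp only [linkHalfEdges, Set.mem_setOf_eq, Pi.add_apply, Pi.single_eq_same]
  omega

omit [Group G] in
/-- A positive-time observable shifted by `τ` depends only on the links of the site half `{x₀ ≥ 0}`. [folklore] -/
theorem dependsOn_comp_gaugeTimeShift_site [MeasurableSpace G] {α : Type*} {F : LGConfig 4 G → α}
    (hF : DependsOn F posTimeEdges) : DependsOn (F ∘ gaugeTimeShift) (siteHalfEdges 0) :=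
  (dependsOn_comp_gaugeTimeShift hF).mono fun e he => by
    simp only [linkHalfEdges, siteHalfEdges, Set.mem_setOf_eq] at he ⊢
    omega

omit [Group G] in
/-- A bounded `𝓔₊`-measurable observable depends only on the positive-time links. [folklore] -/
theorem dependsOn_of_isBoundedMeasurable [MeasurableSpace G] {F : LGConfig 4 G → ℂ}
    (hF : IsBoundedMeasurable (posTimeEvents G) F) : DependsOn F posTimeEdges :=
  dependsOn_of_measurable_cylinderEvents' hF.1

end Geometry

/-! ### §2. Invariances of torus limit points under `τ` and `Θ` -/

section Invariance

variable {G : Type} [Group G] [TopologicalSpace G] [IsTopologicalGroup G] [CompactSpace G]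
  [MeasurableSpace G] [BorelSpace G] [T2Space G] [SecondCountableTopology G]
  {N : ℕ} (ρ : G →* Matrix (Fin N) (Fin N) ℂ)

/-- **Every torus limit point is invariant under the unit time shift `τ`** (translation invariance of limit
points). [folklore] -/
theorem measurePreserving_gaugeTimeShift_of_mem {β : ℝ} {μ : Measure (LGConfig 4 G)}
    (hμ : μ ∈ infiniteVolumeLimitPoints (d := 4) ρ β) : MeasurePreserving gaugeTimeShift μ μ :=
  ⟨measurable_gaugeTimeShift, isZdTranslationInvariant_of_mem_infiniteVolumeLimitPoints ρ hμ _⟩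

/-- **Every torus limit point is invariant under the bond time reflection `Θ`** (`Θ = τ ∘ Θ_site`; axis-reflection
invariance from the gauge-boot cell, translation invariance from the tree). [folklore] -/
theorem measurePreserving_gaugeTimeReflect_of_mem (hρ : Continuous ρ) {β : ℝ} {μ : Measure (LGConfig 4 G)}
    (hμ : μ ∈ infiniteVolumeLimitPoints (d := 4) ρ β) : MeasurePreserving gaugeTimeReflect μ μ := by
  have heq : (gaugeTimeReflect : LGConfig 4 G → LGConfig 4 G) = gaugeTimeShift ∘ configSiteReflect 0 :=
    funext fun U => gaugeTimeReflect_eq_gaugeTimeShift_configSiteReflect U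
  rw [heq]
  exact (measurePreserving_gaugeTimeShift_of_mem ρ hμ).comp (reflectInvariant_of_mem_infiniteVolumeLimitPoints ρ hρ hμ 0)

/-- Measure form of `Θ`-invariance. [folklore] -/
theorem map_gaugeTimeReflect_eq_of_mem (hρ : Continuous ρ) {β : ℝ} {μ : Measure (LGConfig 4 G)}
    (hμ : μ ∈ infiniteVolumeLimitPoints (d := 4) ρ β) : μ.map gaugeTimeReflect = μ :=
  (measurePreserving_gaugeTimeReflect_of_mem ρ hρ hμ).map_eq

/-- Measure form of `τ`-invariance. [folklore] -/
theorem map_gaugeTimeShift_eq_of_mem {β : ℝ} {μ : Measure (LGConfig 4 G)}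
    (hμ : μ ∈ infiniteVolumeLimitPoints (d := 4) ρ β) : μ.map gaugeTimeShift = μ :=
  (measurePreserving_gaugeTimeShift_of_mem ρ hμ).map_eq

end Invariance

/-! ### §3. The four Osterwalder–Schrader premises for a torus limit point -/

section Premises

variable {G : Type} [Group G] [TopologicalSpace G] [IsTopologicalGroup G] [CompactSpace G]
  [MeasurableSpace G] [BorelSpace G] [T2Space G] [SecondCountableTopology G]
  {N : ℕ} (ρ : G →* Matrix (Fin N) (Fin N) ℂ)

/-- **Reflection positivity (OS3) of every torus limit point for the bond reflection**: `0 ≤ Re b(F, F)` for bounded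
`𝓔₊`-measurable `F` — LINK reflection positivity of the limit point (gauge-boot
`linkRP_zero_of_mem_infiniteVolumeLimitPoints`) applied to `F ∘ τ`, transported back by `τ`-invariance and
`τ ∘ Θ_link = Θ ∘ τ`. [folklore] -/
theorem osForm_self_re_nonneg_of_mem (hρ : Continuous ρ) {β : ℝ} (hβ : 0 ≤ β) {μ : Measure (LGConfig 4 G)}
    (hμ : μ ∈ infiniteVolumeLimitPoints (d := 4) ρ β) {F : LGConfig 4 G → ℂ}
    (hF : IsBoundedMeasurable (posTimeEvents G) F) :
    0 ≤ (osForm μ gaugeTimeReflect F F).re := by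
  obtain ⟨hFm, C, hC⟩ := hF
  have hFm' : Measurable F := hFm.mono cylinderEvents_le_pi le_rfl
  have hdep : DependsOn (F ∘ gaugeTimeShift) (linkHalfEdges 0) :=
    dependsOn_comp_gaugeTimeShift (dependsOn_of_isBoundedMeasurable ⟨hFm, C, hC⟩)
  have hL := linkRP_zero_of_mem_infiniteVolumeLimitPoints ρ hρ hβ hμ (F ∘ gaugeTimeShift)
    (hFm'.comp measurable_gaugeTimeShift) ⟨C, fun U => hC _⟩ hdep
  have key : ∫ U, conj ((F ∘ gaugeTimeShift) (configLinkReflect 0 U)) * (F ∘ gaugeTimeShift) U ∂μ =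
      osForm μ gaugeTimeReflect F F := by
    have hμτ : μ.map (⇑(configShift (G := G) (-(Pi.single (0 : Fin 4) (1 : ℤ))))) = μ :=
      map_gaugeTimeShift_eq_of_mem ρ hμ
    have h2 := integral_map_equiv (μ := μ) (configShift (G := G) (-(Pi.single (0 : Fin 4) (1 : ℤ))))
      (fun V => conj (F (gaugeTimeReflect V)) * F V)
    rw [hμτ] at h2
    rw [osForm, h2]
    refine integral_congr_ae (ae_of_all _ fun U => ?_)
    simp only [Function.comp_apply, gaugeTimeShift_configLinkReflect]
    rfl
  rw [key] at hL
  exact (Complex.nonneg_iff.1 hL).1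

/-- **Reflection positivity half a step up**: `0 ≤ Re b(F, F ∘ τ)` for bounded `𝓔₊`-measurable `F` — SITE reflection
positivity of the limit point (`siteRP_zero_of_mem_infiniteVolumeLimitPoints`) applied to `F ∘ τ`, read through
`Θ = τ ∘ Θ_site`. [folklore] -/
theorem osForm_shift_re_nonneg_of_mem (hρ : Continuous ρ) {β : ℝ} (hβ : 0 ≤ β) {μ : Measure (LGConfig 4 G)}
    (hμ : μ ∈ infiniteVolumeLimitPoints (d := 4) ρ β) {F : LGConfig 4 G → ℂ}
    (hF : IsBoundedMeasurable (posTimeEvents G) F) :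
    0 ≤ (osForm μ gaugeTimeReflect F (F ∘ gaugeTimeShift)).re := by
  obtain ⟨hFm, C, hC⟩ := hF
  have hFm' : Measurable F := hFm.mono cylinderEvents_le_pi le_rfl
  have hdep : DependsOn (F ∘ gaugeTimeShift) (siteHalfEdges 0) :=
    dependsOn_comp_gaugeTimeShift_site (dependsOn_of_isBoundedMeasurable ⟨hFm, C, hC⟩)
  have hS := siteRP_zero_of_mem_infiniteVolumeLimitPoints ρ hρ hβ hμ (F ∘ gaugeTimeShift)
    (hFm'.comp measurable_gaugeTimeShift) ⟨C, fun U => hC _⟩ hdep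
  have key : ∫ U, conj ((F ∘ gaugeTimeShift) (configSiteReflect 0 U)) * (F ∘ gaugeTimeShift) U ∂μ =
      osForm μ gaugeTimeReflect F (F ∘ gaugeTimeShift) := by
    refine integral_congr_ae (ae_of_all _ fun U => ?_)
    simp only [Function.comp_apply, gaugeTimeReflect_eq_gaugeTimeShift_configSiteReflect]
  rw [key] at hS
  exact (Complex.nonneg_iff.1 hS).1

/-- **Hermitian symmetry of the OS form of a torus limit point**: `conj b(G, F) = b(F, G)`, from `Θ`-invariance and
`Θ ∘ Θ = id`. [folklore] -/
theorem osForm_conj_symm_of_mem (hρ : Continuous ρ) {β : ℝ} {μ : Measure (LGConfig 4 G)}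
    (hμ : μ ∈ infiniteVolumeLimitPoints (d := 4) ρ β) (F G' : LGConfig 4 G → ℂ) :
    conj (osForm μ gaugeTimeReflect G' F) = osForm μ gaugeTimeReflect F G' := by
  obtain ⟨eΘ, heΘ⟩ := exists_measurableEquiv_gaugeTimeReflect (G := G)
  have hμΘ : μ.map eΘ = μ := by rw [heΘ]; exact map_gaugeTimeReflect_eq_of_mem ρ hρ hμ
  simp only [osForm, ← integral_conj, map_mul, Complex.conj_conj]
  have h2 := integral_map_equiv (μ := μ) eΘ (fun U => conj (F (gaugeTimeReflect U)) * G' U)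
  rw [hμΘ] at h2
  rw [h2]
  refine integral_congr_ae (ae_of_all _ fun U => ?_)
  simp only [heΘ, gaugeTimeReflect_gaugeTimeReflect, mul_comm]

/-- **Shift symmetry of the OS form of a torus limit point**: `b(F, G ∘ τ) = b(F ∘ τ, G)`, from `τ`-invariance and
`τ ∘ Θ ∘ τ = Θ`. [folklore] -/
theorem osForm_shift_symm_of_mem {β : ℝ} {μ : Measure (LGConfig 4 G)}
    (hμ : μ ∈ infiniteVolumeLimitPoints (d := 4) ρ β) (F G' : LGConfig 4 G → ℂ) :
    osForm μ gaugeTimeReflect F (G' ∘ gaugeTimeShift) = osForm μ gaugeTimeReflect (F ∘ gaugeTimeShift) G' := by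
  have hμτ : μ.map (⇑(configShift (G := G) (-(Pi.single (0 : Fin 4) (1 : ℤ))))) = μ :=
    map_gaugeTimeShift_eq_of_mem ρ hμ
  simp only [osForm, Function.comp_apply]
  have h2 := integral_map_equiv (μ := μ) (configShift (G := G) (-(Pi.single (0 : Fin 4) (1 : ℤ))))
    (fun U => conj (F (gaugeTimeShift (gaugeTimeReflect U))) * G' U)
  rw [hμτ] at h2
  rw [h2]
  refine integral_congr_ae (ae_of_all _ fun U => ?_)
  change _ = conj (F (gaugeTimeShift (gaugeTimeReflect (gaugeTimeShift U)))) * G' (gaugeTimeShift U)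
  rw [gaugeTimeShift_gaugeTimeReflect_gaugeTimeShift]

end Premises

/-! ### §4. OS reconstructibility of every torus limit point -/

section Main

variable {G : Type} [Group G] [TopologicalSpace G] [IsTopologicalGroup G] [CompactSpace G]
  [MeasurableSpace G] [BorelSpace G] [T2Space G] [SecondCountableTopology G]
  {N : ℕ} (ρ : G →* Matrix (Fin N) (Fin N) ℂ)

/-- **Every torus limit point is Osterwalder–Schrader reconstructible** for the bond time reflection
`gaugeTimeReflect`, the unit time shift `gaugeTimeShift` and the positive-time σ-algebra `posTimeEvents G`: for a
continuous representation `ρ` of a compact metrisable group `G`, `β ≥ 0`, and ANY infinite-volume limit point `μ` of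
the torus Wilson states — limits along an arbitrary strictly increasing sequence of torus sides `L_k + 1`, EVEN OR ODD —
the premises `IsOSReconstructible μ Θ τ 𝓔₊` of the lattice OS reconstruction hold (reflection positivity from link RP
of limit points, RP half a step up from site RP, hermitian and shift symmetry from `Θ`-, `τ`-invariance). No
`CylinderApprox` ∕ `CylinderExt` side condition and no parity restriction (compare
`CriticalContinuumLimit.AdmissibleGap.isOSReconstructible_of_oddTorusLimit`). (Osterwalder–Seiler 1978 §2; FILS 1978
§3; Glimm–Jaffe 1987 Thm. 6.1.3.) [folklore] -/
theorem isOSReconstructible_of_mem_infiniteVolumeLimitPoints (hρ : Continuous ρ) {β : ℝ} (hβ : 0 ≤ β)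
    {μ : Measure (LGConfig 4 G)} (hμ : μ ∈ infiniteVolumeLimitPoints (d := 4) ρ β) :
    IsOSReconstructible μ gaugeTimeReflect gaugeTimeShift (posTimeEvents G) where
  le := cylinderEvents_le_pi
  measurable_reflect := measurable_gaugeTimeReflect
  rp _ hF := osForm_self_re_nonneg_of_mem ρ hρ hβ hμ hF
  conj_symm F G' _ _ := osForm_conj_symm_of_mem ρ hρ hμ F G'
  measurable_comp_shift _ hG' := hG'.comp measurable_gaugeTimeShift_posTimeEvents
  shift_symm F G' _ _ := osForm_shift_symm_of_mem ρ hμ F G'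
  rp_shift _ hF := osForm_shift_re_nonneg_of_mem ρ hρ hβ hμ hF

/-- **OS reconstructibility of limits along a given side sequence** (the raw-side currency of the programme's
volume classes: `IsInfiniteVolumeLimitAlong ρ β L μ`, tori of sides `L k + 1` with `L` strictly increasing — Track
A's even family tori `2·L^n` included). [folklore] -/
theorem isOSReconstructible_of_isInfiniteVolumeLimitAlong (hρ : Continuous ρ) {β : ℝ} (hβ : 0 ≤ β)
    {L : ℕ → ℕ} (hL : StrictMono L) {μ : Measure (LGConfig 4 G)}
    (hμ : IsInfiniteVolumeLimitAlong (d := 4) ρ β L μ) :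
    IsOSReconstructible μ gaugeTimeReflect gaugeTimeShift (posTimeEvents G) :=
  isOSReconstructible_of_mem_infiniteVolumeLimitPoints ρ hρ hβ ⟨L, hL, hμ⟩

/-- **OS reconstructibility of odd-torus limit states, hypothesis-free form**: every
`μ ∈ oddTorusLimitPoints r β` (`β ≥ 0`) is OS-reconstructible — the statement of
`CriticalContinuumLimit.AdmissibleGap.isOSReconstructible_of_oddTorusLimit` without its `CylinderApprox μ` and
`CylinderExt G` binders. [folklore] -/
theorem isOSReconstructible_of_mem_oddTorusLimitPoints (r : LatticeRep G) {β : ℝ} (hβ : 0 ≤ β)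
    {μ : Measure (LGConfig 4 G)} (hμ : μ ∈ oddTorusLimitPoints r β) :
    IsOSReconstructible μ gaugeTimeReflect gaugeTimeShift (posTimeEvents G) := by
  obtain ⟨S, hS, h⟩ := hμ
  exact isOSReconstructible_of_isInfiniteVolumeLimitAlong r.ρ r.continuous hβ
    (fun a b hab => by have := hS hab; change 2 * S a < 2 * S b; omega) h

end Main

end Summit.QuantumFields.YangMills.Theorems.InfVolRP

end
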